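import Mathlib
import HarnessLib
import Summits.FinalStateConjecture.Statement
import Literature.Geometry.Lorentzian.LandauLifshitzPseudotensor
import Summits.FinalStateConjecture.FinalStateConjecture.Theorems.EIHFluxBalanceInertialRecessionLabVelocity

/-!
# Route EIHFluxBalance — `InertialRecession`, line `old-light-leaves-the-cone`:
# stub `stub_paintedVelocityKinematics` (S3a, kinematics of the painted lab velocities)

Helper file for the crux `stmt-FinalStateConjecture-10166`
(`Summit.FinalStateConjecture.FinalStateConjecture.Theses.EIHFluxBalance.InertialRecession`).

The hypothesis of `InertialRecession` paints every hole `i` with a Lorentz motion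
`Λᵢ : ℝ → lorentzGroup = O(1,3)` which is smooth as a `CLM`-valued map and has Lorentz factor
`|(Λᵢ(t) e₀)⁰| ≤ γ`. The **painted lab velocity** of hole `i` at lab time `t` is
`vᵢ(t) := ((Λᵢ(t) e₀)⁰)⁻¹ • (Λᵢ(t) e₀)~ ∈ E3`. This file proves the two purely kinematical facts
about these velocities consumed by the Mathlib-only endgame of the line (stub S4):

* `continuous_labVelocity_of_contDiff_lorentz` : `t ↦ vᵢ(t)` is continuous — evaluate the smooth
  `CLM`-valued map at the constant vector `e₀` (`ContDiff.clm_apply`), then apply the lab-velocity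
  map `u ↦ (u⁰)⁻¹ ũ`, smooth on `{u⁰ ≠ 0}` (`contDiff_labVelocity`), using `|(Λ e₀)⁰| ≥ 1`
  (`one_le_abs_lorentz_apply_zero`);
* `norm_labVelocity_sq_le_of_abs_le` : the SIGN-BLIND speed bound `‖v‖² ≤ 1 − (γ²)⁻¹` whenever
  `|(Λ e₀)⁰| ≤ γ` (`O(1,3)` is not orthochronous, so `(Λ e₀)⁰` may be `≤ −1`; the identity
  `((Λ e₀)⁰)² = 1 + ‖(Λ e₀)~‖²`, `lorentz_apply_zero_sq`, only sees `|(Λ e₀)⁰|`);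

and assembles them into the registered stub `stub_paintedVelocityKinematics`: under the crux
antecedent, every `vᵢ` is continuous and `‖vᵢ(t)‖ ≤ k := √(1 − (max γ 1)⁻²) < 1` for all `i, t`
(the `max` makes the vacuous case `N = 0`, where `γ` is unconstrained, uniform with `N ≥ 1`,
where `γ ≥ 1` automatically).

References: O'Neill 1983, *Semi-Riemannian geometry*, Ch. 9, pp. 233–236 (`O(1,3)`, unit timelike
vectors, `γ(v) = (1 − ‖v‖²)^{-1/2}`).
-/

noncomputable section

-- the doubled `FinalStateConjecture.FinalStateConjecture` path component trips dupNamespace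
set_option linter.dupNamespace false

namespace Summit.FinalStateConjecture.FinalStateConjecture.Theorems

open scoped BigOperators Topology Manifold Classical MeasureTheory Matrix InnerProductSpace ContDiff ENNReal
open Filter Set Function TopologicalSpace MeasureTheory Literature.Geometry.Lorentzian

/-! ### Continuity of the painted lab velocity -/

/-- **The painted lab velocity of a smooth Lorentz motion is smooth**: if
`t ↦ (Λ(t) : E4 →L[ℝ] E4)` is `Cⁿ`, then so is `t ↦ ((Λ(t) e₀)⁰)⁻¹ • (Λ(t) e₀)~` — evaluation at
the constant vector `e₀` is `Cⁿ` (`ContDiff.clm_apply`) and the lab-velocity map is smooth on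
`{u⁰ ≠ 0} ∋ Λ(t) e₀` (`contDiff_labVelocity`; `(Λ e₀)⁰ ≠ 0` because `|(Λ e₀)⁰| ≥ 1`,
`one_le_abs_lorentz_apply_zero`). O'Neill 1983, Ch. 9, p. 233. [folklore] -/
theorem contDiff_labVelocity_of_contDiff_lorentz {L : ℝ → lorentzGroup} {n : WithTop ℕ∞}
    (hL : ContDiff ℝ n (fun t ↦ ((L t : E4 ≃L[ℝ] E4) : E4 →L[ℝ] E4))) :
    ContDiff ℝ n (fun t ↦ ((((L t : E4 ≃L[ℝ] E4) (E4.basisVector 0)) 0)⁻¹ •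
      E4.spatial ((L t : E4 ≃L[ℝ] E4) (E4.basisVector 0)))) := by
  have h2 : ContDiff ℝ n (fun t ↦ ((L t : E4 ≃L[ℝ] E4) : E4 →L[ℝ] E4) (E4.basisVector 0)) :=
    hL.clm_apply contDiff_const
  have h3 : ∀ s, (((L s : E4 ≃L[ℝ] E4) : E4 →L[ℝ] E4) (E4.basisVector 0)) 0 ≠ 0 := fun s h0 ↦ by
    have h1 := one_le_abs_lorentz_apply_zero (L s)
    rw [ContinuousLinearEquiv.coe_coe] at h0
    rw [h0, abs_zero] at h1
    exact absurd h1 (by norm_num)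
  exact contDiff_labVelocity h2 h3

/-- **The painted lab velocity of a smooth Lorentz motion is continuous** (the continuity
clause of stub S3a): `Cⁿ ⇒ C⁰` applied to `contDiff_labVelocity_of_contDiff_lorentz`.
O'Neill 1983, Ch. 9, p. 233. [folklore] -/
theorem continuous_labVelocity_of_contDiff_lorentz {L : ℝ → lorentzGroup} {n : WithTop ℕ∞}
    (hL : ContDiff ℝ n (fun t ↦ ((L t : E4 ≃L[ℝ] E4) : E4 →L[ℝ] E4))) :
    Continuous (fun t ↦ ((((L t : E4 ≃L[ℝ] E4) (E4.basisVector 0)) 0)⁻¹ •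
      E4.spatial ((L t : E4 ≃L[ℝ] E4) (E4.basisVector 0)))) :=
  (contDiff_labVelocity_of_contDiff_lorentz hL).continuous

/-! ### The sign-blind speed bound -/

/-- **Speed bound from the Lorentz factor, sign-blind form**: for `u = Λ e₀`, `Λ ∈ O(1,3)`, with
`|u⁰| ≤ γ`, `‖(u⁰)⁻¹ ũ‖² ≤ 1 − (γ²)⁻¹` — from `(u⁰)² = 1 + ‖ũ‖²` (`lorentz_apply_zero_sq`), so
`‖(u⁰)⁻¹ ũ‖² = 1 − (u⁰)⁻² ≤ 1 − γ⁻²`; the non-orthochronous sign `u⁰ ≤ −1` is covered since only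
`|u⁰|` enters (`norm_smul`, `norm_inv`). O'Neill 1983, Ch. 9, p. 233. [folklore] -/
theorem norm_labVelocity_sq_le_of_abs_le (Λ : lorentzGroup) {γ : ℝ}
    (hγ : |((Λ : E4 ≃L[ℝ] E4) (E4.basisVector 0)) 0| ≤ γ) :
    ‖((((Λ : E4 ≃L[ℝ] E4) (E4.basisVector 0)) 0)⁻¹ •
      E4.spatial ((Λ : E4 ≃L[ℝ] E4) (E4.basisVector 0)))‖ ^ 2 ≤ 1 - (γ ^ 2)⁻¹ := by
  have hsq := lorentz_apply_zero_sq Λ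
  have h1 := one_le_abs_lorentz_apply_zero Λ
  generalize hu0 : ((Λ : E4 ≃L[ℝ] E4) (E4.basisVector 0)) 0 = u0 at hsq h1 hγ ⊢
  generalize hs : E4.spatialNorm ((Λ : E4 ≃L[ℝ] E4) (E4.basisVector 0)) = sn at hsq
  have hsn : ‖E4.spatial ((Λ : E4 ≃L[ℝ] E4) (E4.basisVector 0))‖ = sn := hs
  rw [norm_smul, norm_inv, Real.norm_eq_abs, hsn, mul_pow, inv_pow, sq_abs]
  have h0 : 0 < |u0| := one_pos.trans_le h1
  have hγ0 : 0 < γ := h0.trans_le hγ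
  have hu : u0 ≠ 0 := abs_pos.mp h0
  have h2 : (u0 ^ 2)⁻¹ * sn ^ 2 = 1 - (u0 ^ 2)⁻¹ := by
    have hu2 : u0 ^ 2 ≠ 0 := pow_ne_zero 2 hu
    rw [show sn ^ 2 = u0 ^ 2 - 1 by linarith, mul_sub, inv_mul_cancel₀ hu2, mul_one]
  have h3 : (γ ^ 2)⁻¹ ≤ (u0 ^ 2)⁻¹ := by
    apply inv_anti₀ (by positivity)
    rw [← sq_abs u0]
    exact pow_le_pow_left₀ (abs_nonneg _) hγ 2
  rw [h2]
  linarith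

/-- The sign-blind speed bound as a norm bound with the uniform constant
`k = √(1 − ((max γ 1)²)⁻¹)`: `‖(u⁰)⁻¹ ũ‖ ≤ k` for `u = Λ e₀` with `|u⁰| ≤ γ`, and `0 ≤ k < 1`
(bookkeeping: `|u⁰| ≤ γ ≤ max γ 1`, `Real.le_sqrt_of_sq_le`, `Real.sqrt_lt'`). O'Neill 1983,
Ch. 9, p. 233. [folklore] -/
theorem norm_labVelocity_le_sqrt_max (Λ : lorentzGroup) {γ : ℝ}
    (hγ : |((Λ : E4 ≃L[ℝ] E4) (E4.basisVector 0)) 0| ≤ γ) :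
    ‖((((Λ : E4 ≃L[ℝ] E4) (E4.basisVector 0)) 0)⁻¹ •
      E4.spatial ((Λ : E4 ≃L[ℝ] E4) (E4.basisVector 0)))‖ ≤ Real.sqrt (1 - ((max γ 1) ^ 2)⁻¹) :=
  Real.le_sqrt_of_sq_le (norm_labVelocity_sq_le_of_abs_le Λ (hγ.trans (le_max_left _ _)))

/-- `0 ≤ √(1 − ((max γ 1)²)⁻¹) < 1` for every real `γ` (arithmetic bookkeeping for the uniform
subluminal constant of stub S3a). [folklore] -/
theorem sqrt_one_sub_inv_max_sq_lt_one (γ : ℝ) :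
    0 ≤ Real.sqrt (1 - ((max γ 1) ^ 2)⁻¹) ∧ Real.sqrt (1 - ((max γ 1) ^ 2)⁻¹) < 1 := by
  refine ⟨Real.sqrt_nonneg _, ?_⟩
  rw [Real.sqrt_lt' one_pos, one_pow]
  have : 0 < ((max γ 1) ^ 2)⁻¹ := by positivity
  linarith

/-! ### The registered stub -/

/-- **S3a — KINEMATICS OF THE PAINTED VELOCITIES (Lorentz-group bookkeeping), registered stub
`stub_paintedVelocityKinematics` of line `old-light-leaves-the-cone`, crux `InertialRecession`.**
Under the crux antecedent the painted lab velocities `vᵢ(t) = ((Λᵢ(t)e₀)⁰)⁻¹ (Λᵢ(t)e₀)~` are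
continuous in `t` (`Λᵢ` is smooth as a `CLM`-valued map and `|(Λe₀)⁰| ≥ 1`;
`continuous_labVelocity_of_contDiff_lorentz`) and uniformly subluminal:
`‖vᵢ(t)‖ ≤ k := √(1 − (max γ 1)⁻²) < 1` for ALL `t` (hence eventually), from the Lorentz clause
`|(Λᵢ(t)e₀)⁰| ≤ γ` and `((Λe₀)⁰)² = 1 + ‖(Λe₀)~‖²` (`norm_labVelocity_le_sqrt_max`, sign-blind).
Only the Lorentz-factor clause and the smoothness clause of the antecedent are used. O'Neill 1983,
Ch. 9, p. 233. [folklore] -/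
theorem stub_paintedVelocityKinematics :
    ∀ (X : Type) [TopologicalSpace X] [ChartedSpace E3 X] [IsManifold (𝓡 3) ((⊤ : ℕ∞) : WithTop ℕ∞) X] [T2Space X] [SecondCountableTopology X] [ConnectedSpace X], ∀ D ∈ admissibleVacuumData X, ∀ 𝒟 : VacuumCauchyDevelopment D, 𝒟.IsMaximal → ∀ (N : ℕ) (M a rin : Fin N → ℝ) (Λ : Fin N → ℝ → lorentzGroup) (ξ : Fin N → ℝ → E3) (γ κ τ₀ : ℝ) (U : Opens E4) (Φ : U → 𝒟.carrier) (O : Set 𝒟.carrier), ((∀ i, Kerr.IsSubextremal (M i) (a i) ∧ Kerr.rMinus (M i) (a i) < rin i ∧ rin i < Kerr.rPlus (M i) (a i)) ∧ (∀ i t, |((Λ i t : E4 ≃L[ℝ] E4) (E4.basisVector 0)) 0| ≤ γ) ∧ (∀ i, ContDiff ℝ ((⊤ : ℕ∞) : WithTop ℕ∞) (ξ i) ∧ ContDiff ℝ ((⊤ : ℕ∞) : WithTop ℕ∞) (fun t ↦ ((Λ i t : E4 ≃L[ℝ] E4) : E4 →L[ℝ] E4))) ∧ (∀ i j, i ≠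 j → Tendsto (fun t ↦ ‖ξ i t - ξ j t‖) atTop atTop) ∧ (0 < κ ∧ κ < 1 ∧ ∀ i, ∀ᶠ t in atTop, ‖ξ i t‖ ≤ κ ^ 2 * t) ∧ ({x : E4 | τ₀ < x 0 ∧ ∀ i, rin i < Kerr.radius (a i) (poincareInv (Λ i (x 0)) (E4.ofTimeSpace (x 0) (ξ i (x 0))) x)} ⊆ (U : Set E4)) ∧ let B : ModelBackground := ⟨U, fun x ↦ Minkowski.bilin + ∑ i, (boostedKerrBilin (Λ i (x 0)) (E4.ofTimeSpace (x 0) (ξ i (x 0))) (M i) (a i) x - Minkowski.bilin), fun x ↦ x 0, E4.spatialNorm⟩; ContMDiff 𝓘(ℝ, E4) (𝓡 4) ((⊤ : ℕ∞) : WithTop ℕ∞) Φ ∧ Topology.IsOpenEmbedding ((B.lateRegion τ₀).restrict Φ) ∧ Φ '' {x : U | τ₀ < x.1 0 ∧ ∀ i, Kerr.rPlus (M i) (a i) < Kerr.radius (a i) (poincareInv (Λ i (x.1 0)) (E4.ofTimeSpace (x.1 0) (ξ i (x.1 0))) x.1)} ⊆ O ∧ Tendsto (fun t ↦ 𝒟.toSpacetime.deviationCk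 B Φ 3 t) atTop (𝓝 0) ∧ Tendsto (fun t : ℝ ↦ ⨆ x ∈ {x : U | x.1 0 = t ∧ E4.spatialNorm x.1 ≤ κ * t}, ⨆ (m : ℕ) (_ : m ≤ 3), ENNReal.ofReal (1 + √(√((⨅ i, ‖E4.spatial x.1 - ξ i t‖) ^ 7))) * ‖iteratedFDeriv ℝ m (𝒟.toSpacetime.deviationExtend B Φ) x.1‖ₑ) atTop (𝓝 0) ∧ O = Summit.FinalStateConjecture.exteriorOf 𝒟.toCauchyDevelopment (Φ '' {x : U | τ₀ < x.1 0 ∧ ∀ i, Kerr.rPlus (M i) (a i) < Kerr.radius (a i) (poincareInv (Λ i (x.1 0)) (E4.ofTimeSpace (x.1 0) (ξ i (x.1 0))) x.1)}) ∧ ∀ t₁ : ℝ, τ₀ < t₁ → O \ Φ '' {x : U | t₁ < x.1 0 ∧ ∀ i, Kerr.rPlus (M i) (a i) < Kerr.radius (a i) (poincareInv (Λ i (x.1 0)) (E4.ofTimeSpace (x.1 0) (ξ i (x.1 0))) x.1)} ⊆ 𝒟.metric.causalPast 𝒟.timeOrientation (Φ '' {x : U | x.1 0 = t₁ ∧ ∀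 i, Kerr.rPlus (M i) (a i) < Kerr.radius (a i) (poincareInv (Λ i (x.1 0)) (E4.ofTimeSpace (x.1 0) (ξ i (x.1 0))) x.1)})) → (∀ i, Continuous (fun t ↦ (((((Λ i t : lorentzGroup) : E4 ≃L[ℝ] E4) (E4.basisVector 0)) 0)⁻¹ • E4.spatial (((Λ i t : lorentzGroup) : E4 ≃L[ℝ] E4) (E4.basisVector 0))))) ∧ (∃ k : ℝ, 0 ≤ k ∧ k < 1 ∧ ∀ i, ∀ᶠ t in atTop, ‖(((((Λ i t : lorentzGroup) : E4 ≃L[ℝ] E4) (E4.basisVector 0)) 0)⁻¹ • E4.spatial (((Λ i t : lorentzGroup) : E4 ≃L[ℝ] E4) (E4.basisVector 0)))‖ ≤ k) := by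
  intro X _ _ _ _ _ _ D _ 𝒟 _ N M a rin Λ ξ γ κ τ₀ U Φ O h
  obtain ⟨-, hγ, hsmooth, -⟩ := h
  obtain ⟨hk0, hk1⟩ := sqrt_one_sub_inv_max_sq_lt_one γ
  exact ⟨fun i ↦ continuous_labVelocity_of_contDiff_lorentz (hsmooth i).2,
    Real.sqrt (1 - ((max γ 1) ^ 2)⁻¹), hk0, hk1,
    fun i ↦ Eventually.of_forall fun t ↦ norm_labVelocity_le_sqrt_max (Λ i t) (hγ i t)⟩

/-- Registered one-line form (carrier `sqrt_one_sub_inv_max_sq_lt_one_sce12` of the crux item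
stmt-FinalStateConjecture-17403) of `sqrt_one_sub_inv_max_sq_lt_one`. [folklore] -/
theorem sqrt_one_sub_inv_max_sq_lt_one_sce12 : ∀ (γ : ℝ), 0 ≤ Real.sqrt (1 - ((max γ 1) ^ 2)⁻¹) ∧ Real.sqrt (1 - ((max γ 1) ^ 2)⁻¹) < 1 :=
  fun γ ↦ sqrt_one_sub_inv_max_sq_lt_one γ

end Summit.FinalStateConjecture.FinalStateConjecture.Theorems

end
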